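import Summits.BirchSwinnertonDyer.BirchSwinnertonDyer.Theorems.SmallImageMuTransferMuZeroCMKatzFrame
import Summits.BirchSwinnertonDyer.BirchSwinnertonDyer.Theorems.SignedLowerHalvesKobayashiMainConjectureSmallImageCMTransferMuRecords10
import Summits.BirchSwinnertonDyer.BirchSwinnertonDyer.Theorems.Rank1ResidualIntModelReduction
import Summits.BirchSwinnertonDyer.Rank1Residual.X11b.ChaPairsMinimality
import Summits.BirchSwinnertonDyer.Rank1Residual.Additive.PointCountEulerNat
import HarnessLib

/-!
# Crux `CycTangentCM.CycTangentBound` (stmt-BirchSwinnertonDyer-22628), negative road: the two WITNESS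
# CURVES of the lead's numerical refutation, with every ANCHOR BINDER of the crux decided in the kernel
# (`--supports 22628`; nothing is closed here; the crux is NOT claimed false by this file; BSD is not proved)

Seat `prover-bsd-line-ctcm-p5` (WIDTH-5 attach seat on D-0145 line `route-BirchSwinnertonDyer-CycTangentCM`,
line `tangent-cone-parity`).  The lead (`bsd-line-ctcm-p1` g2, cell STATUS 2026-08-28T00:41:46Z, crux workfile
`Cruxes/CycTangentBound/REFUTED.md`) reports the crux NUMERICALLY REFUTED at the two pairs

* `W1 = [0,0,0,0,−2]` (`y² = x³ − 2`, conductor `1728`, the sextic twist `27a ⊗ 6`), `p = 7`;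
* `W2 = [0,0,1,0,−33163]` (`y² + y = x³ − 33163`, conductor `7803 = 27·17²`, the twist `27a ⊗ 17`), `p = 7`;

both with `j = 0` (CM by `ℤ[ζ₃]`, `K = ℚ(√−3)`, `7` split), `a_7 = 1` (ANOMALOUS good ordinary), analytic rank `1`,
`λ_7 = 5`, and announces the kernel file `Negative/…FalseOfNumerics` (`¬ CycTangentBound` modulo the frame facts and
named numerical facts, via `not_cycTangentBound_of_fwdDiffCertificate`, p589997, with `k = 2`).  That file must
INSTANTIATE the crux at `A := W1` (or `W2`), `p := 7`, i.e. discharge the crux's anchor binders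
`[A.IsElliptic] [A.IsGloballyMinimal]`, `5 ≤ 7`, `A.j ∈ maximalCMJInvariants`, `A.HasGoodReductionAtPrime 7`,
`¬ 7 ∣ a_7(A)`, `A.HasIrreducibleModPGaloisRep 7`.  THIS FILE supplies exactly these, unconditionally and
kernel-decided (`decide +kernel`, no `native_decide`), for BOTH witnesses, plus the frame package at each
witness modulo the two named frame facts (`MuZeroCMKatzFrame.katzFrame_of_facts`):

* `isElliptic_w2`, `isGloballyMinimal_w2` — `Δ(W2) = −3⁹·17⁶ ≠ 0`, no prime has `q¹² ∣ Δ` (Kraus' bounded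
  criterion `X11b.isGloballyMinimal_of_krausCriterion_bounded₂`); for `W1` (`Δ = −2⁶3³`) these are the tree's
  `Theorems.isElliptic_cm0m2` / `Theorems.isGloballyMinimal_cm0m2` (reused, not restated).
* `intModel_w1/_w2` — the integral model is the literal integer equation.
* `card_w1_7 = 7`, `card_w1_11 = 12`, `card_w2_7 = 7`, `card_w2_11 = 12` — point counts over `𝔽_7`, `𝔽_11`
  (`PointCountNat.natCard_point_map_eq`): `a_7 = 1` (anomalous), `a_11 = 0` (`11` inert in `ℚ(√−3)`).
* `j_w1/_w2 = 0 ∈ maximalCMJInvariants` (`c₄ = 0`).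
* `hasGoodReductionAtPrime_w1_7/_w2_7`, `frobeniusTrace_w1_7/_w2_7 = 1`, hence `¬ 7 ∣ a_7`.
* `hasIrreducibleModPGaloisRep_w1_7/_w2_7` — Mazur's Frobenius certificate
  (`IntModel.hasIrreducibleModPGaloisRep_of_intModel_of_noroot`) at the good prime `ℓ = 11`: `X² − a₁₁X + 11 =
  X² + 11 ≡ X² + 4` has NO root modulo `7` (`−4 = 3` is a non-residue mod `7`); at a split CM prime `p` only an
  INERT witness `ℓ` can work (Frobenius at primes split in `K` lies in the split Cartan, whose characteristic
  polynomial splits mod `p`).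
* `anchor_w1_7/_w2_7` — the five anchor binders bundled; `exists_frame_w1_7/_w2_7` — the full `ψ⁻¹`-twisted
  two-variable frame package at the witness (`katzFrame_of_facts`, CONDITIONAL on the named facts
  `DeShalit1987.thmII417_exists_katzSheet` and `Deuring_exists_heckeCharacter_of_maximalCM`).
(The consumable interface `¬ CycTangentBound ⟸ a certificate on every frame at the witness` is the sequel file
  `CycTangentCMCycTangentBoundWitnessInterface`.)

Nothing here asserts anything about the values of the frame: the numerical facts (Hurwitz-type numbers
`s_7, s_13`, `λ_7 = 5`) and the assembly are the lead's.  Theorems only; no `def`, no named fact, no `sorry`.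
References: [Mazur1978] §6 Prop. 6.3 (1); [SilvermanAEC2009] VII.1 Rem. 1.1, VII.5 Prop. 5.1, App. C §11;
[Kraus1989] Prop. 1–2; [CremonaAlgorithms1997] Table 1 (curve 1728 = `[0,0,0,0,−2]`); lead memo
`Cruxes/CycTangentBound/REFUTED.md` (commit a640892a8233).
-/

set_option linter.dupNamespace false
set_option autoImplicit false

noncomputable section

open scoped Classical NumberField
open WeierstrassCurve NumberField IsDedekindDomain Field
open Literature.NumberTheory.EllipticCurves Literature.NumberTheory.GaloisRepresentations
open Literature.NumberTheory.EllipticCurves.Rank1Residual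
open Summit.BirchSwinnertonDyer.BirchSwinnertonDyer.Rank1Residual
open Summit.BirchSwinnertonDyer.Rank1Residual.X11b
open Summit.BirchSwinnertonDyer.Rank1Residual.Additive

namespace Summit.BirchSwinnertonDyer.BirchSwinnertonDyer.Theorems.CycTangentCMWitness

/-! ## §1 The first witness `W1 = [0,0,0,0,−2]` : `y² = x³ − 2` (conductor `1728`) at `p = 7` -/

-- `W1` is elliptic and globally minimal: ALREADY in the tree as `Theorems.isElliptic_cm0m2`,
-- `Theorems.isGloballyMinimal_cm0m2` (file `SignedLowerHalvesKobayashiMainConjectureSmallImageCMTransferMuRecords10`,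
-- where `[0,0,0,0,−2]` is a CM partner at `p = 5`); reused here, not restated.

/-- The integral model of `W1` is the literal integer equation `[0,0,0,0,−2]`. [folklore] -/
theorem intModel_w1 :
    haveI := isGloballyMinimal_cm0m2
    integralModelInt (⟨0, 0, 0, 0, -2⟩ : WeierstrassCurve ℚ) = (⟨0, 0, 0, 0, -2⟩ : WeierstrassCurve ℤ) := by
  haveI := isGloballyMinimal_cm0m2
  exact IntModel.integralModelInt_eq_of_map_eq _ (IntModel.map_mk_int 0 0 0 0 (-2))

/-- `#W̃1(𝔽_7) = 7`, i.e. `a_7(W1) = 1`: `7` is an ANOMALOUS good ordinary prime of `y² = x³ − 2`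
(kernel-decided `ℕ`-arithmetic Euler count). [folklore] -/
theorem card_w1_7 :
    Nat.card (((⟨0, 0, 0, 0, -2⟩ : WeierstrassCurve ℤ).map (Int.castRingHom (ZMod 7))).toAffine.Point) = 7 := by
  rw [PointCountNat.natCard_point_map_eq (hℓ := ⟨by norm_num⟩) (by norm_num) 0 0 0 0 (-2)
    (by decide +kernel)]
  decide +kernel

/-- `#W̃1(𝔽_11) = 12`, i.e. `a_11(W1) = 0` (`11 ≡ 2 (mod 3)` is inert in `ℚ(√−3)`: supersingular); the
Frobenius witness for irreducibility mod `7` (kernel-decided). [folklore] -/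
theorem card_w1_11 :
    Nat.card (((⟨0, 0, 0, 0, -2⟩ : WeierstrassCurve ℤ).map (Int.castRingHom (ZMod 11))).toAffine.Point) = 12 := by
  rw [PointCountNat.natCard_point_map_eq (hℓ := ⟨by norm_num⟩) (by norm_num) 0 0 0 0 (-2)
    (by decide +kernel)]
  decide +kernel

/-- `j(W1) = 0` (`c₄ = 0`). [cite: SilvermanAEC2009, III.1] -/
theorem j_w1 : haveI := isElliptic_cm0m2; (⟨0, 0, 0, 0, -2⟩ : WeierstrassCurve ℚ).j = 0 := by
  haveI := isElliptic_cm0m2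
  rw [j_eq_c₄_pow_div]
  norm_num [WeierstrassCurve.c₄, WeierstrassCurve.b₂, WeierstrassCurve.b₄]

/-- `j(W1) = 0` is a maximal-order CM invariant (CM by `ℤ[ζ₃]`). [cite: SilvermanAEC2009, App. C §11] -/
theorem j_w1_mem_maximalCMJInvariants :
    haveI := isElliptic_cm0m2; (⟨0, 0, 0, 0, -2⟩ : WeierstrassCurve ℚ).j ∈ maximalCMJInvariants := by
  rw [j_w1, maximalCMJInvariants]; simp

/-- `W1` has good reduction at `7` (`7 ∤ Δ = −1728`). [cite: SilvermanAEC2009, VII.5 Prop. 5.1 (a)] -/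
theorem hasGoodReductionAtPrime_w1_7 :
    haveI := isGloballyMinimal_cm0m2; haveI : Fact (Nat.Prime 7) := ⟨by norm_num⟩
    (⟨0, 0, 0, 0, -2⟩ : WeierstrassCurve ℚ).HasGoodReductionAtPrime 7 := by
  haveI := isGloballyMinimal_cm0m2
  haveI : Fact (Nat.Prime 7) := ⟨by norm_num⟩
  exact hasGoodReductionAtPrime_of_not_dvd _ 7
    (by rw [IntModel.minimalDiscriminantInt_eq intModel_w1]; decide +kernel)

/-- `a_7(W1) = 1`: `7` is ANOMALOUS for `y² = x³ − 2` (`#W̃1(𝔽_7) = 7`). [folklore] -/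
theorem frobeniusTrace_w1_7 :
    haveI := isGloballyMinimal_cm0m2; haveI : Fact (Nat.Prime 7) := ⟨by norm_num⟩
    (⟨0, 0, 0, 0, -2⟩ : WeierstrassCurve ℚ).frobeniusTrace 7 = 1 := by
  haveI := isGloballyMinimal_cm0m2
  haveI : Fact (Nat.Prime 7) := ⟨by norm_num⟩
  rw [IntModel.frobeniusTrace_eq intModel_w1 card_w1_7]; norm_num

/-- `7 ∤ a_7(W1)` (`a_7 = 1`): `7` is good ORDINARY for `W1`. [folklore] -/
theorem not_dvd_frobeniusTrace_w1_7 :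
    haveI := isGloballyMinimal_cm0m2; haveI : Fact (Nat.Prime 7) := ⟨by norm_num⟩
    ¬ ((7 : ℕ) : ℤ) ∣ (⟨0, 0, 0, 0, -2⟩ : WeierstrassCurve ℚ).frobeniusTrace 7 := by
  rw [frobeniusTrace_w1_7]; decide

/-- **`W1[7]` is an irreducible `Γ_ℚ`-module** (Mazur's Frobenius certificate at the good prime `ℓ = 11`:
`a_11 = 0` and `X² + 11 ≡ X² + 4` has no root modulo `7`, `3` being a non-residue). [cite: Mazur1978, §6 Prop. 6.3 (1)] -/
theorem hasIrreducibleModPGaloisRep_w1_7 :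
    haveI : Fact (Nat.Prime 7) := ⟨by norm_num⟩
    (⟨0, 0, 0, 0, -2⟩ : WeierstrassCurve ℚ).HasIrreducibleModPGaloisRep 7 := by
  have hn : ∀ t : ZMod 7, t ^ 2 - (((11 : ℕ) : ℤ) + 1 - (12 : ℕ) : ℤ) * t + ((11 : ℕ) : ZMod 7) ≠ 0 := by
    decide +kernel
  haveI : Fact (Nat.Prime 7) := ⟨by norm_num⟩
  haveI : Fact (Nat.Prime 11) := ⟨by norm_num⟩
  haveI := isElliptic_cm0m2
  haveI := isGloballyMinimal_cm0m2
  exact IntModel.hasIrreducibleModPGaloisRep_of_intModel_of_noroot intModel_w1 7 11 (by norm_num)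
    (by decide +kernel) (n := 12) card_w1_11 hn

/-- **The five anchor binders of the crux at `(W1, 7)`, bundled**: `5 ≤ 7`, `j ∈ maximalCMJInvariants`, good
reduction at `7`, `7 ∤ a_7`, `W1[7]` irreducible. [cite: Mazur1978, §6 Prop. 6.3 (1)] -/
theorem anchor_w1_7 :
    haveI := isElliptic_cm0m2; haveI := isGloballyMinimal_cm0m2; haveI : Fact (Nat.Prime 7) := ⟨by norm_num⟩
    5 ≤ 7 ∧ (⟨0, 0, 0, 0, -2⟩ : WeierstrassCurve ℚ).j ∈ maximalCMJInvariants ∧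
      (⟨0, 0, 0, 0, -2⟩ : WeierstrassCurve ℚ).HasGoodReductionAtPrime 7 ∧
      ¬ ((7 : ℕ) : ℤ) ∣ (⟨0, 0, 0, 0, -2⟩ : WeierstrassCurve ℚ).frobeniusTrace 7 ∧
      (⟨0, 0, 0, 0, -2⟩ : WeierstrassCurve ℚ).HasIrreducibleModPGaloisRep 7 :=
  ⟨by norm_num, j_w1_mem_maximalCMJInvariants, hasGoodReductionAtPrime_w1_7, not_dvd_frobeniusTrace_w1_7,
    hasIrreducibleModPGaloisRep_w1_7⟩

/-- **The `ψ⁻¹`-twisted two-variable frame package EXISTS at the witness `(W1, 7)`**, modulo the two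
named frame facts (de Shalit II.4.17, Deuring): `MuZeroCMKatzFrame.katzFrame_of_facts` at the anchor
`anchor_w1_7`.  The objects the lead's `¬ CycTangentBound` assembly is instantiated on.
[cite: deShalit1987, II.4.17 (54) (p. 78)] [cite: SilvermanATAEC1994, Ch. II Thm. 9.2 and Thm. 10.5 (b)] -/
theorem exists_frame_w1_7 (hdS : DeShalit1987.thmII417_exists_katzSheet)
    (hDeu : Deuring_exists_heckeCharacter_of_maximalCM) :
    haveI := isElliptic_cm0m2; haveI := isGloballyMinimal_cm0m2; haveI : Fact (Nat.Prime 7) := ⟨by norm_num⟩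
    ∃ (K : Type) (_ : Field K) (_ : NumberField K),
      IsCMFieldOfJ K (⟨0, 0, 0, 0, -2⟩ : WeierstrassCurve ℚ).j ∧
      ∃ (ψ : HeckeCharacter K), ψ.HasInfinityType (fun _ ↦ 1) (fun _ ↦ 0) ∧
        (∀ s : ℂ, 3 / 2 < s.re →
          heckeLFunction ψ s = (⟨0, 0, 0, 0, -2⟩ : WeierstrassCurve ℚ).LSeries s) ∧
      ∃ (ι : PadicAlgCl 7 ≃+* ℂ) (v vbar : HeightOneSpectrum (𝓞 K)),
        ((7 : ℕ) : 𝓞 K) ∈ v.asIdeal ∧ ((7 : ℕ) : 𝓞 K) ∈ vbar.asIdeal ∧ vbar ≠ v ∧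
        (∀ (w : InfinitePlace K) (k : 𝓞 K), k ∈ v.asIdeal ↔ ‖ι.symm (w.embedding (k : K))‖ < 1) ∧
      ∃ (S : Finset (HeightOneSpectrum (𝓞 K))), v ∉ S ∧ vbar ∉ S ∧
        (∀ w ∈ S, ¬ ψ.IsUnramifiedAt w) ∧
        (∀ w : HeightOneSpectrum (𝓞 K), w ∉ S → ψ.IsUnramifiedAt w) ∧
      ∃ (κ₁ κ₂ : ZpExtension K 7) (γ₁ γ₂ : absoluteGaloisGroup K),
        ZpExtension.IsTopGeneratorPair κ₁ κ₂ γ₁ γ₂ ∧ κ₂.IsCyclotomic ∧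
        (∃ ζ : ℤ_[7]ˣ, IsOfFinOrder ζ ∧
          ((GaloisRep.cyclotomicCharacter K 7 γ₂ * ζ : ℤ_[7]ˣ) : ℤ_[7]) =
            (cyclotomicGenerator 7 : ℤ_[7])) ∧
      ∃ (Ω δ : ℂ) (Ωp : ℂ_[7]), Ω ≠ 0 ∧ Ωp ≠ 0 ∧
        (δ ^ 2 = (NumberField.discr K : ℂ) ∨ δ ^ 2 = -(NumberField.discr K : ℂ)) ∧
      ∃ (G : PowerSeries (PowerSeries (PadicComplexInt 7))),
        IsKatzMeasure₂ ι v vbar S κ₁ κ₂ γ₁ γ₂ ψ⁻¹ Ω δ Ωp G := by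
  haveI := isElliptic_cm0m2
  haveI := isGloballyMinimal_cm0m2
  haveI : Fact (Nat.Prime 7) := ⟨by norm_num⟩
  obtain ⟨h5, hj, hgood, hord, hirr⟩ := anchor_w1_7
  exact MuZeroCMKatzFrame.katzFrame_of_facts hdS hDeu _ 7 h5 hj hgood hord hirr

/-! ## §2 The second witness `W2 = [0,0,1,0,−33163]` : `y² + y = x³ − 33163` (conductor `7803 = 27·17²`) at `p = 7` -/

/-- `W2 : y² + y = x³ − 33163` is an elliptic curve over `ℚ` (`Δ = −3⁹·17⁶ ≠ 0`, kernel-checked). [folklore] -/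
theorem isElliptic_w2 : (⟨0, 0, 1, 0, -33163⟩ : WeierstrassCurve ℚ).IsElliptic :=
  isElliptic_of_discOf_ne_zero 0 0 1 0 (-33163) (by decide +kernel)

/-- `W2 : y² + y = x³ − 33163` is a global minimal equation (`Δ = −3⁹·17⁶`: no `q¹² ∣ Δ`; Kraus' bounded
criterion, kernel-checked). [cite: SilvermanAEC2009, VII.1 Remark 1.1] [cite: Kraus1989, Prop. 1 and Prop. 2] -/
theorem isGloballyMinimal_w2 : (⟨0, 0, 1, 0, -33163⟩ : WeierstrassCurve ℚ).IsGloballyMinimal :=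
  isGloballyMinimal_of_krausCriterion_bounded₂ 0 0 1 0 (-33163) (by decide +kernel) (by decide +kernel)
    (by decide +kernel)

/-- The integral model of `W2` is the literal integer equation `[0,0,1,0,−33163]`. [folklore] -/
theorem intModel_w2 :
    haveI := isGloballyMinimal_w2
    integralModelInt (⟨0, 0, 1, 0, -33163⟩ : WeierstrassCurve ℚ) =
      (⟨0, 0, 1, 0, -33163⟩ : WeierstrassCurve ℤ) := by
  haveI := isGloballyMinimal_w2
  exact IntModel.integralModelInt_eq_of_map_eq _ (IntModel.map_mk_int 0 0 1 0 (-33163))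

/-- `#W̃2(𝔽_7) = 7`, i.e. `a_7(W2) = 1`: `7` is an ANOMALOUS good ordinary prime of `y² + y = x³ − 33163`
(kernel-decided). [folklore] -/
theorem card_w2_7 :
    Nat.card (((⟨0, 0, 1, 0, -33163⟩ : WeierstrassCurve ℤ).map (Int.castRingHom (ZMod 7))).toAffine.Point) = 7 := by
  rw [PointCountNat.natCard_point_map_eq (hℓ := ⟨by norm_num⟩) (by norm_num) 0 0 1 0 (-33163)
    (by decide +kernel)]
  decide +kernel

/-- `#W̃2(𝔽_11) = 12`, i.e. `a_11(W2) = 0` (`11` inert in `ℚ(√−3)`); the Frobenius witness for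
irreducibility mod `7` (kernel-decided). [folklore] -/
theorem card_w2_11 :
    Nat.card (((⟨0, 0, 1, 0, -33163⟩ : WeierstrassCurve ℤ).map (Int.castRingHom (ZMod 11))).toAffine.Point) = 12 := by
  rw [PointCountNat.natCard_point_map_eq (hℓ := ⟨by norm_num⟩) (by norm_num) 0 0 1 0 (-33163)
    (by decide +kernel)]
  decide +kernel

/-- `j(W2) = 0` (`c₄ = 0`). [cite: SilvermanAEC2009, III.1] -/
theorem j_w2 : haveI := isElliptic_w2; (⟨0, 0, 1, 0, -33163⟩ : WeierstrassCurve ℚ).j = 0 := by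
  haveI := isElliptic_w2
  rw [j_eq_c₄_pow_div]
  norm_num [WeierstrassCurve.c₄, WeierstrassCurve.b₂, WeierstrassCurve.b₄]

/-- `j(W2) = 0` is a maximal-order CM invariant (CM by `ℤ[ζ₃]`). [cite: SilvermanAEC2009, App. C §11] -/
theorem j_w2_mem_maximalCMJInvariants :
    haveI := isElliptic_w2; (⟨0, 0, 1, 0, -33163⟩ : WeierstrassCurve ℚ).j ∈ maximalCMJInvariants := by
  rw [j_w2, maximalCMJInvariants]; simp

/-- `W2` has good reduction at `7` (`7 ∤ Δ = −3⁹·17⁶`). [cite: SilvermanAEC2009, VII.5 Prop. 5.1 (a)] -/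
theorem hasGoodReductionAtPrime_w2_7 :
    haveI := isGloballyMinimal_w2; haveI : Fact (Nat.Prime 7) := ⟨by norm_num⟩
    (⟨0, 0, 1, 0, -33163⟩ : WeierstrassCurve ℚ).HasGoodReductionAtPrime 7 := by
  haveI := isGloballyMinimal_w2
  haveI : Fact (Nat.Prime 7) := ⟨by norm_num⟩
  exact hasGoodReductionAtPrime_of_not_dvd _ 7
    (by rw [IntModel.minimalDiscriminantInt_eq intModel_w2]; decide +kernel)

/-- `a_7(W2) = 1`: `7` is ANOMALOUS for `y² + y = x³ − 33163` (`#W̃2(𝔽_7) = 7`). [folklore] -/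
theorem frobeniusTrace_w2_7 :
    haveI := isGloballyMinimal_w2; haveI : Fact (Nat.Prime 7) := ⟨by norm_num⟩
    (⟨0, 0, 1, 0, -33163⟩ : WeierstrassCurve ℚ).frobeniusTrace 7 = 1 := by
  haveI := isGloballyMinimal_w2
  haveI : Fact (Nat.Prime 7) := ⟨by norm_num⟩
  rw [IntModel.frobeniusTrace_eq intModel_w2 card_w2_7]; norm_num

/-- `7 ∤ a_7(W2)` (`a_7 = 1`): `7` is good ORDINARY for `W2`. [folklore] -/
theorem not_dvd_frobeniusTrace_w2_7 :
    haveI := isGloballyMinimal_w2; haveI : Fact (Nat.Prime 7) := ⟨by norm_num⟩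
    ¬ ((7 : ℕ) : ℤ) ∣ (⟨0, 0, 1, 0, -33163⟩ : WeierstrassCurve ℚ).frobeniusTrace 7 := by
  rw [frobeniusTrace_w2_7]; decide

/-- **`W2[7]` is an irreducible `Γ_ℚ`-module** (Mazur's Frobenius certificate at the good prime `ℓ = 11`:
`a_11 = 0`, `X² + 11` has no root modulo `7`). [cite: Mazur1978, §6 Prop. 6.3 (1)] -/
theorem hasIrreducibleModPGaloisRep_w2_7 :
    haveI : Fact (Nat.Prime 7) := ⟨by norm_num⟩
    (⟨0, 0, 1, 0, -33163⟩ : WeierstrassCurve ℚ).HasIrreducibleModPGaloisRep 7 := by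
  have hn : ∀ t : ZMod 7, t ^ 2 - (((11 : ℕ) : ℤ) + 1 - (12 : ℕ) : ℤ) * t + ((11 : ℕ) : ZMod 7) ≠ 0 := by
    decide +kernel
  haveI : Fact (Nat.Prime 7) := ⟨by norm_num⟩
  haveI : Fact (Nat.Prime 11) := ⟨by norm_num⟩
  haveI := isElliptic_w2
  haveI := isGloballyMinimal_w2
  exact IntModel.hasIrreducibleModPGaloisRep_of_intModel_of_noroot intModel_w2 7 11 (by norm_num)
    (by decide +kernel) (n := 12) card_w2_11 hn

/-- **The five anchor binders of the crux at `(W2, 7)`, bundled.** [cite: Mazur1978, §6 Prop. 6.3 (1)] -/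
theorem anchor_w2_7 :
    haveI := isElliptic_w2; haveI := isGloballyMinimal_w2; haveI : Fact (Nat.Prime 7) := ⟨by norm_num⟩
    5 ≤ 7 ∧ (⟨0, 0, 1, 0, -33163⟩ : WeierstrassCurve ℚ).j ∈ maximalCMJInvariants ∧
      (⟨0, 0, 1, 0, -33163⟩ : WeierstrassCurve ℚ).HasGoodReductionAtPrime 7 ∧
      ¬ ((7 : ℕ) : ℤ) ∣ (⟨0, 0, 1, 0, -33163⟩ : WeierstrassCurve ℚ).frobeniusTrace 7 ∧
      (⟨0, 0, 1, 0, -33163⟩ : WeierstrassCurve ℚ).HasIrreducibleModPGaloisRep 7 :=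
  ⟨by norm_num, j_w2_mem_maximalCMJInvariants, hasGoodReductionAtPrime_w2_7, not_dvd_frobeniusTrace_w2_7,
    hasIrreducibleModPGaloisRep_w2_7⟩

/-- **The `ψ⁻¹`-twisted two-variable frame package EXISTS at the witness `(W2, 7)`**, modulo the two
named frame facts (de Shalit II.4.17, Deuring): `MuZeroCMKatzFrame.katzFrame_of_facts` at `anchor_w2_7`.
[cite: deShalit1987, II.4.17 (54) (p. 78)] [cite: SilvermanATAEC1994, Ch. II Thm. 9.2 and Thm. 10.5 (b)] -/
theorem exists_frame_w2_7 (hdS : DeShalit1987.thmII417_exists_katzSheet)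
    (hDeu : Deuring_exists_heckeCharacter_of_maximalCM) :
    haveI := isElliptic_w2; haveI := isGloballyMinimal_w2; haveI : Fact (Nat.Prime 7) := ⟨by norm_num⟩
    ∃ (K : Type) (_ : Field K) (_ : NumberField K),
      IsCMFieldOfJ K (⟨0, 0, 1, 0, -33163⟩ : WeierstrassCurve ℚ).j ∧
      ∃ (ψ : HeckeCharacter K), ψ.HasInfinityType (fun _ ↦ 1) (fun _ ↦ 0) ∧
        (∀ s : ℂ, 3 / 2 < s.re →
          heckeLFunction ψ s = (⟨0, 0, 1, 0, -33163⟩ : WeierstrassCurve ℚ).LSeries s) ∧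
      ∃ (ι : PadicAlgCl 7 ≃+* ℂ) (v vbar : HeightOneSpectrum (𝓞 K)),
        ((7 : ℕ) : 𝓞 K) ∈ v.asIdeal ∧ ((7 : ℕ) : 𝓞 K) ∈ vbar.asIdeal ∧ vbar ≠ v ∧
        (∀ (w : InfinitePlace K) (k : 𝓞 K), k ∈ v.asIdeal ↔ ‖ι.symm (w.embedding (k : K))‖ < 1) ∧
      ∃ (S : Finset (HeightOneSpectrum (𝓞 K))), v ∉ S ∧ vbar ∉ S ∧
        (∀ w ∈ S, ¬ ψ.IsUnramifiedAt w) ∧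
        (∀ w : HeightOneSpectrum (𝓞 K), w ∉ S → ψ.IsUnramifiedAt w) ∧
      ∃ (κ₁ κ₂ : ZpExtension K 7) (γ₁ γ₂ : absoluteGaloisGroup K),
        ZpExtension.IsTopGeneratorPair κ₁ κ₂ γ₁ γ₂ ∧ κ₂.IsCyclotomic ∧
        (∃ ζ : ℤ_[7]ˣ, IsOfFinOrder ζ ∧
          ((GaloisRep.cyclotomicCharacter K 7 γ₂ * ζ : ℤ_[7]ˣ) : ℤ_[7]) =
            (cyclotomicGenerator 7 : ℤ_[7])) ∧
      ∃ (Ω δ : ℂ) (Ωp : ℂ_[7]), Ω ≠ 0 ∧ Ωp ≠ 0 ∧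
        (δ ^ 2 = (NumberField.discr K : ℂ) ∨ δ ^ 2 = -(NumberField.discr K : ℂ)) ∧
      ∃ (G : PowerSeries (PowerSeries (PadicComplexInt 7))),
        IsKatzMeasure₂ ι v vbar S κ₁ κ₂ γ₁ γ₂ ψ⁻¹ Ω δ Ωp G := by
  haveI := isElliptic_w2
  haveI := isGloballyMinimal_w2
  haveI : Fact (Nat.Prime 7) := ⟨by norm_num⟩
  obtain ⟨h5, hj, hgood, hord, hirr⟩ := anchor_w2_7
  exact MuZeroCMKatzFrame.katzFrame_of_facts hdS hDeu _ 7 h5 hj hgood hord hirr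

end Summit.BirchSwinnertonDyer.BirchSwinnertonDyer.Theorems.CycTangentCMWitness

end
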